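import Summits.KontsevichZagierPeriods.KontsevichZagierPeriods.Theorems.RootDecompZetaThreeFrontierWordMatchPreludeP11

/-! # `RootDecompZetaThreeFrontierWordMatchPreludeP12` — part 4/6 of the mechanical ≤340-line split of `src.lean`
(split by the decomp-kz census seat for landing; mathematics unchanged; part 4 continues part 3). -/

set_option linter.dupNamespace false

noncomputable section

namespace Summit.KontsevichZagierPeriods.KontsevichZagierPeriods.Cruxes.GZNormalFormWThree.GZLadder
open Set MeasureTheory Literature.NumberTheory.Transcendental
open Summit.KontsevichZagierPeriods.RootDecompZetaThreeFrontier
open Summit.KontsevichZagierPeriods.KontsevichZagierPeriods.Theorems.RootDecompZetaThreeFrontierWordMoves (measurableSet_simplex ibpQ1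
  dualRep3 dualRep3_integrand mem_simplex_three_duΦ integrableOn_comp_duΦ)

/-- **Q-generic t₁-LOWERING STEP** (`β₁ = b+1 ↦ b`, `γ₁ = c ↦ c+1`). -/
theorem lowerT1Q (N Q : MvPolynomial (Fin 3) ℚ) (β₀ b c γ₂ α : ℕ) (hb : 1 ≤ b)
    (hRint : IntegrableOn (WordLayer.layerF (WordLayer.lowR1Q N Q b c) β₀ b (c + 1) γ₂ α) (KZ.openOrderedSimplex 3))
    (hR : ∀ s : KZ.IntegralRep 3, s.domain = simplex 3 →
      EqOn s.integrand (WordLayer.layerF (WordLayer.lowR1Q N Q b c) β₀ b (c + 1) γ₂ α) s.domain → CongInto (layerThree ∪ gzLETwo) (KZ.of s))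
    (r : KZ.IntegralRep 3) (hd : r.domain = simplex 3) (hi : EqOn r.integrand (WordLayer.layerF N β₀ (b + 1) c γ₂ α) r.domain) :
    CongInto (layerThree ∪ gzLETwo) (KZ.of r) :=
  stepT1 N (MvPolynomial.C (-(1 / (b : ℚ))) * N + MvPolynomial.X 1 * Q) (WordLayer.lowR1Q N Q b c)
    β₀ (b + 1) c γ₂ α b c β₀ b (c + 1) γ₂ α
    (fun t ht => by rw [← WordLayer.lowerT1Q_identity N Q β₀ b c γ₂ α hb ht]; ring) hRint hR r hd hi

/-- **Q-generic γ₁-preserving t₁-LOWERING STEP** (`β₁ = b+1 ↦ b`, `γ₁ = c+1` kept). -/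
theorem lowerT1'Q (N Q : MvPolynomial (Fin 3) ℚ) (β₀ b c γ₂ α : ℕ) (hb : 1 ≤ b)
    (hRint : IntegrableOn (WordLayer.layerF (WordLayer.lowR1'Q N Q b c) β₀ b (c + 1) γ₂ α) (KZ.openOrderedSimplex 3))
    (hR : ∀ s : KZ.IntegralRep 3, s.domain = simplex 3 →
      EqOn s.integrand (WordLayer.layerF (WordLayer.lowR1'Q N Q b c) β₀ b (c + 1) γ₂ α) s.domain → CongInto (layerThree ∪ gzLETwo) (KZ.of s))
    (r : KZ.IntegralRep 3) (hd : r.domain = simplex 3) (hi : EqOn r.integrand (WordLayer.layerF N β₀ (b + 1) (c + 1) γ₂ α) r.domain) :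
    CongInto (layerThree ∪ gzLETwo) (KZ.of r) :=
  stepT1 N (MvPolynomial.C (-(1 / (b : ℚ))) * N + MvPolynomial.X 1 * Q) (WordLayer.lowR1'Q N Q b c)
    β₀ (b + 1) (c + 1) γ₂ α b c β₀ b (c + 1) γ₂ α
    (fun t ht => by rw [← WordLayer.lowerT1'Q_identity N Q β₀ b c γ₂ α hb ht]; ring) hRint hR r hd hi

/-- **Q-generic t₀-LOWERING STEP** (`α = a+1 ↦ a`, `β₀ = g ↦ g+1`; σ₃-dual of `lowerT2Q`). -/
theorem lowerT0Q (N Q : MvPolynomial (Fin 3) ℚ) (g β₁ γ₁ γ₂ a : ℕ) (ha : 1 ≤ a)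
    (hRint : IntegrableOn (WordLayer.layerF (WordLayer.lowR0Q N Q g a) (g + 1) β₁ γ₁ γ₂ a) (KZ.openOrderedSimplex 3))
    (hR : ∀ s : KZ.IntegralRep 3, s.domain = simplex 3 →
      EqOn s.integrand (WordLayer.layerF (WordLayer.lowR0Q N Q g a) (g + 1) β₁ γ₁ γ₂ a) s.domain → CongInto (layerThree ∪ gzLETwo) (KZ.of s))
    (r : KZ.IntegralRep 3) (hd : r.domain = simplex 3) (hi : EqOn r.integrand (WordLayer.layerF N g β₁ γ₁ γ₂ (a + 1)) r.domain) :
    CongInto (layerThree ∪ gzLETwo) (KZ.of r) := by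
  refine congInto_of_dual _ r hd (lowerT2Q (WordLayer.duP3 N) (WordLayer.duP3 Q) γ₂ γ₁ β₁ g a ha ?_ (fun s hs hsi => ?_)
    (dualRep3 r hd) rfl fun t ht => ?_)
  · refine (integrableOn_comp_duΦ hRint).congr_fun (fun t _ => ?_) (measurableSet_simplex 3)
    show WordLayer.layerF (WordLayer.lowR0Q N Q g a) (g + 1) β₁ γ₁ γ₂ a _ = _
    rw [layerF_duΦ, WordLayer.lowR0Q, WordLayer.duP3_duP3]
  · refine congInto_of_dual _ s hs (hR (dualRep3 s hs) rfl fun t ht => ?_)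
    rw [dualRep3_integrand, hsi (by rw [hs]; exact mem_simplex_three_duΦ ht), layerF_duΦ, WordLayer.lowR0Q]
  · rw [dualRep3_integrand, hi (by rw [hd]; exact mem_simplex_three_duΦ ht), layerF_duΦ]

/-- **Q-generic β₀-LOWERING STEP** (`β₀ = g+1 ↦ g`, `α = a ↦ a+1`; σ₃-dual of `lowerC2Q`). -/
theorem lowerB0Q (N Q : MvPolynomial (Fin 3) ℚ) (g β₁ γ₁ γ₂ a : ℕ) (hg : 1 ≤ g)
    (hRint : IntegrableOn (WordLayer.layerF (WordLayer.lowRb0Q N Q g a) g β₁ γ₁ γ₂ (a + 1)) (KZ.openOrderedSimplex 3))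
    (hR : ∀ s : KZ.IntegralRep 3, s.domain = simplex 3 →
      EqOn s.integrand (WordLayer.layerF (WordLayer.lowRb0Q N Q g a) g β₁ γ₁ γ₂ (a + 1)) s.domain → CongInto (layerThree ∪ gzLETwo) (KZ.of s))
    (r : KZ.IntegralRep 3) (hd : r.domain = simplex 3) (hi : EqOn r.integrand (WordLayer.layerF N (g + 1) β₁ γ₁ γ₂ a) r.domain) :
    CongInto (layerThree ∪ gzLETwo) (KZ.of r) := by
  refine congInto_of_dual _ r hd (lowerC2Q (WordLayer.duP3 N) (WordLayer.duP3 Q) γ₂ γ₁ β₁ g a hg ?_ (fun s hs hsi => ?_)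
    (dualRep3 r hd) rfl fun t ht => ?_)
  · refine (integrableOn_comp_duΦ hRint).congr_fun (fun t _ => ?_) (measurableSet_simplex 3)
    show WordLayer.layerF (WordLayer.lowRb0Q N Q g a) g β₁ γ₁ γ₂ (a + 1) _ = _
    rw [layerF_duΦ, WordLayer.lowRb0Q, WordLayer.duP3_duP3]
  · refine congInto_of_dual _ s hs (hR (dualRep3 s hs) rfl fun t ht => ?_)
    rw [dualRep3_integrand, hsi (by rw [hs]; exact mem_simplex_three_duΦ ht), layerF_duΦ, WordLayer.lowRb0Q]
  · rw [dualRep3_integrand, hi (by rw [hd]; exact mem_simplex_three_duΦ ht), layerF_duΦ]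

/-- **Q-generic DUAL t₁-LOWERING STEP** (`γ₁ = b+1 ↦ b`, `β₁ = c ↦ c+1`; σ₃-dual of `lowerT1Q`). -/
theorem lowerT1dQ (N Q : MvPolynomial (Fin 3) ℚ) (β₀ c b γ₂ α : ℕ) (hb : 1 ≤ b)
    (hRint : IntegrableOn (WordLayer.layerF (WordLayer.lowR1dQ N Q b c) β₀ (c + 1) b γ₂ α) (KZ.openOrderedSimplex 3))
    (hR : ∀ s : KZ.IntegralRep 3, s.domain = simplex 3 →
      EqOn s.integrand (WordLayer.layerF (WordLayer.lowR1dQ N Q b c) β₀ (c + 1) b γ₂ α) s.domain → CongInto (layerThree ∪ gzLETwo) (KZ.of s))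
    (r : KZ.IntegralRep 3) (hd : r.domain = simplex 3) (hi : EqOn r.integrand (WordLayer.layerF N β₀ c (b + 1) γ₂ α) r.domain) :
    CongInto (layerThree ∪ gzLETwo) (KZ.of r) := by
  refine congInto_of_dual _ r hd (lowerT1Q (WordLayer.duP3 N) (WordLayer.duP3 Q) γ₂ b c β₀ α hb ?_ (fun s hs hsi => ?_)
    (dualRep3 r hd) rfl fun t ht => ?_)
  · refine (integrableOn_comp_duΦ hRint).congr_fun (fun t _ => ?_) (measurableSet_simplex 3)
    show WordLayer.layerF (WordLayer.lowR1dQ N Q b c) β₀ (c + 1) b γ₂ α _ = _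
    rw [layerF_duΦ, WordLayer.lowR1dQ, WordLayer.duP3_duP3]
  · refine congInto_of_dual _ s hs (hR (dualRep3 s hs) rfl fun t ht => ?_)
    rw [dualRep3_integrand, hsi (by rw [hs]; exact mem_simplex_three_duΦ ht), layerF_duΦ, WordLayer.lowR1dQ]
  · rw [dualRep3_integrand, hi (by rw [hd]; exact mem_simplex_three_duΦ ht), layerF_duΦ]

/-- **Q-generic DUAL β₁-preserving t₁-LOWERING STEP** (`γ₁ = b+1 ↦ b`, `β₁ = c+1` kept; σ₃-dual of `lowerT1'Q`). -/
theorem lowerT1d'Q (N Q : MvPolynomial (Fin 3) ℚ) (β₀ c b γ₂ α : ℕ) (hb : 1 ≤ b)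
    (hRint : IntegrableOn (WordLayer.layerF (WordLayer.lowR1d'Q N Q b c) β₀ (c + 1) b γ₂ α) (KZ.openOrderedSimplex 3))
    (hR : ∀ s : KZ.IntegralRep 3, s.domain = simplex 3 →
      EqOn s.integrand (WordLayer.layerF (WordLayer.lowR1d'Q N Q b c) β₀ (c + 1) b γ₂ α) s.domain → CongInto (layerThree ∪ gzLETwo) (KZ.of s))
    (r : KZ.IntegralRep 3) (hd : r.domain = simplex 3) (hi : EqOn r.integrand (WordLayer.layerF N β₀ (c + 1) (b + 1) γ₂ α) r.domain) :
    CongInto (layerThree ∪ gzLETwo) (KZ.of r) := by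
  refine congInto_of_dual _ r hd (lowerT1'Q (WordLayer.duP3 N) (WordLayer.duP3 Q) γ₂ b c β₀ α hb ?_ (fun s hs hsi => ?_)
    (dualRep3 r hd) rfl fun t ht => ?_)
  · refine (integrableOn_comp_duΦ hRint).congr_fun (fun t _ => ?_) (measurableSet_simplex 3)
    show WordLayer.layerF (WordLayer.lowR1d'Q N Q b c) β₀ (c + 1) b γ₂ α _ = _
    rw [layerF_duΦ, WordLayer.lowR1d'Q, WordLayer.duP3_duP3]
  · refine congInto_of_dual _ s hs (hR (dualRep3 s hs) rfl fun t ht => ?_)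
    rw [dualRep3_integrand, hsi (by rw [hs]; exact mem_simplex_three_duΦ ht), layerF_duΦ, WordLayer.lowR1d'Q]
  · rw [dualRep3_integrand, hi (by rw [hd]; exact mem_simplex_three_duΦ ht), layerF_duΦ]

end Summit.KontsevichZagierPeriods.KontsevichZagierPeriods.Cruxes.GZNormalFormWThree.GZLadder

/-! # §37  GAP-WORLD CALCULUS (decomp-kz lens-1 gen 11): the dictionary `ℚ[g₀,g₁,g₂,g₃] → ℚ[t₀,t₁,t₂]` for the `GapClassMatch` induction
(blueprint (a) of NODE.md ADDENDUM 9): `toT` (gᵢ ↦ gaps), `aeval t (toT H) = aeval (gaps t) H`, the den factors and `gsum` under `toT`,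
the CHAIN RULES `pderiv d (toT H) = toT (gD d H)` with `gD 2 = ∂₃ - ∂₂`, `gD 1 = ∂₂ - ∂₁`, `gD 0 = ∂₁ - ∂₀`, duality `duP3 (toT H) = toT (gdual H)`,
and the bridge `layerF (toT (monomial κ q)) B t = q · gapF κ B t`. -/

namespace Summit.KontsevichZagierPeriods.RootDecompZetaThreeFrontier.WordLayer

open Set MeasureTheory Literature.NumberTheory.Transcendental MvPolynomial

section GapCalculus

/-- the gap substitution `g ↦ (1-X₀, X₀-X₁, X₁-X₂, X₂)` -/
noncomputable def gvec : Fin 4 → MvPolynomial (Fin 3) ℚ := ![C 1 - X 0, X 0 - X 1, X 1 - X 2, X 2]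

/-- Auxiliary step `gvec_zero`. [bookkeeping] -/
@[simp] theorem gvec_zero : gvec 0 = C 1 - X 0 := rfl
/-- Auxiliary step `gvec_one`. [bookkeeping] -/
@[simp] theorem gvec_one : gvec 1 = X 0 - X 1 := rfl
/-- Auxiliary step `gvec_two`. [bookkeeping] -/
@[simp] theorem gvec_two : gvec 2 = X 1 - X 2 := rfl
/-- Auxiliary step `gvec_three`. [bookkeeping] -/
@[simp] theorem gvec_three : gvec 3 = X 2 := rfl

/-- `toT : ℚ[g] →ₐ ℚ[t]`, `gᵢ ↦ gvec i` -/
noncomputable def toT : MvPolynomial (Fin 4) ℚ →ₐ[ℚ] MvPolynomial (Fin 3) ℚ := bind₁ gvec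

/-- Auxiliary step `toT_X`. [bookkeeping] -/
@[simp] theorem toT_X (i : Fin 4) : toT (X i) = gvec i := bind₁_X_right _ _
/-- Auxiliary step `toT_C`. [bookkeeping] -/
@[simp] theorem toT_C (q : ℚ) : toT (C q) = C q := bind₁_C_right _ _

/-- Auxiliary step `aeval_gvec`. [bookkeeping] -/
theorem aeval_gvec (t : Fin 3 → ℝ) : (fun i => aeval t (gvec i)) = gaps t := by
  funext i
  fin_cases i <;> simp [gvec]

/-- evaluation commutes with the dictionary -/
theorem aeval_toT (t : Fin 3 → ℝ) (H : MvPolynomial (Fin 4) ℚ) : aeval t (toT H) = aeval (gaps t) H := by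
  rw [toT, aeval_bind₁, aeval_gvec]

/-- Auxiliary step `toT_gsum`. [bookkeeping] -/
theorem toT_gsum : toT gsum = C 1 := by
  simp [gsum]
/-- the five denominator factors as gap-linear forms -/
theorem toT_fB0 : toT (X 1 + X 2 + X 3) = X 0 := by simp
/-- Auxiliary step `toT_fB1`. [bookkeeping] -/
theorem toT_fB1 : toT (X 2 + X 3) = X 1 := by simp
/-- Auxiliary step `toT_fC1`. [bookkeeping] -/
theorem toT_fC1 : toT (X 0 + X 1) = C 1 - X 1 := by simp
/-- Auxiliary step `toT_fC2`. [bookkeeping] -/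
theorem toT_fC2 : toT (X 0 + X 1 + X 2) = C 1 - X 2 := by simp
/-- Auxiliary step `toT_fAl`. [bookkeeping] -/
theorem toT_fAl : toT (X 1 + X 2) = X 0 - X 2 := by simp

/-- homogenisation is invisible in `t`: `toT (H * gsum) = toT H` -/
theorem toT_mul_gsum (H : MvPolynomial (Fin 4) ℚ) : toT (H * gsum) = toT H := by
  rw [map_mul, toT_gsum, map_one, mul_one]

/-- the gap-world directional derivatives `∂/∂t_d` -/
noncomputable def gD (d : Fin 3) (H : MvPolynomial (Fin 4) ℚ) : MvPolynomial (Fin 4) ℚ :=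
  pderiv d.succ H - pderiv d.castSucc H

/-- Auxiliary step `gD_add`. [bookkeeping] -/
theorem gD_add (d : Fin 3) (H H' : MvPolynomial (Fin 4) ℚ) : gD d (H + H') = gD d H + gD d H' := by
  simp only [gD, map_add]; ring

/-- Auxiliary step `gD_mul`. [bookkeeping] -/
theorem gD_mul (d : Fin 3) (H H' : MvPolynomial (Fin 4) ℚ) : gD d (H * H') = gD d H * H' + H * gD d H' := by
  simp only [gD, MvPolynomial.pderiv_mul]; ring

/-- Auxiliary step `gD_C`. [bookkeeping] -/
theorem gD_C (d : Fin 3) (q : ℚ) : gD d (C q) = 0 := by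
  simp [gD]

/-- Auxiliary step `gD_zero`. [bookkeeping] -/
theorem gD_zero (d : Fin 3) : gD d (0 : MvPolynomial (Fin 4) ℚ) = 0 := by
  simp [gD]

/-- Auxiliary step `pderiv_gvec`. [bookkeeping] -/
theorem pderiv_gvec (d : Fin 3) (i : Fin 4) : pderiv d (gvec i) = toT (gD d (X i)) := by
  fin_cases d <;> fin_cases i <;> simp [gD, gvec, pderiv_X]

/-- **CHAIN RULE**: `∂_{t_d} (toT H) = toT (gD d H)` -/
theorem pderiv_toT (d : Fin 3) (H : MvPolynomial (Fin 4) ℚ) : pderiv d (toT H) = toT (gD d H) := by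
  induction H using MvPolynomial.induction_on with
  | C a => simp [gD_C]
  | add p q hp hq => rw [map_add, map_add, hp, hq, gD_add, map_add]
  | mul_X p i hp => rw [map_mul, MvPolynomial.pderiv_mul, hp, toT_X, pderiv_gvec, gD_mul, map_add, map_mul, map_mul, toT_X]

/-- the gap reversal `gᵢ ↦ g₃₋ᵢ` (σ₃-duality in gap coordinates) -/
noncomputable def gdual : MvPolynomial (Fin 4) ℚ →ₐ[ℚ] MvPolynomial (Fin 4) ℚ := bind₁ ![X 3, X 2, X 1, X 0]

/-- Auxiliary step `duP3_gvec`. [bookkeeping] -/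
theorem duP3_gvec (i : Fin 4) : duP3 (gvec i) = toT ((![X 3, X 2, X 1, X 0] : Fin 4 → MvPolynomial (Fin 4) ℚ) i) := by
  fin_cases i <;> simp [gvec, duP3]

/-- **DUALITY in gap coordinates**: `duP3 (toT H) = toT (gdual H)` -/
theorem duP3_toT (H : MvPolynomial (Fin 4) ℚ) : duP3 (toT H) = toT (gdual H) := by
  induction H using MvPolynomial.induction_on with
  | C a => simp [gdual, duP3]
  | add p q hp hq => rw [map_add, map_add, hp, hq, map_add, map_add]
  | mul_X p i hp => rw [map_mul, map_mul, hp, toT_X, duP3_gvec, gdual, map_mul, bind₁_X_right, map_mul, ← gdual]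

/-- **BRIDGE**: a gap monomial under the dictionary is the scaled gap class numerator -/
theorem layerF_toT_monomial (κ : Fin 4 →₀ ℕ) (q : ℚ) (β₀ β₁ γ₁ γ₂ α : ℕ) (t : Fin 3 → ℝ) :
    layerF (toT (monomial κ q)) β₀ β₁ γ₁ γ₂ α t = (q : ℝ) * gapF κ β₀ β₁ γ₁ γ₂ α t := by
  simp only [layerF, aeval_toT, aeval_monomial, gapF, eq_ratCast, Finsupp.prod_pow, Fin.prod_univ_four, gaps_zero, gaps_one, gaps_two,
    gaps_three]
  ring

/-- the class of `toT H` is the coefficient-weighted sum of gap classes -/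
theorem layerF_toT (H : MvPolynomial (Fin 4) ℚ) (β₀ β₁ γ₁ γ₂ α : ℕ) (t : Fin 3 → ℝ) :
    layerF (toT H) β₀ β₁ γ₁ γ₂ α t = ∑ κ ∈ H.support, ((coeff κ H : ℚ) : ℝ) * gapF κ β₀ β₁ γ₁ γ₂ α t := by
  conv_lhs => rw [H.as_sum]
  simp only [layerF, map_sum, aeval_toT, Finset.sum_div]
  refine Finset.sum_congr rfl fun κ _ => ?_
  have := layerF_toT_monomial κ (coeff κ H) β₀ β₁ γ₁ γ₂ α t
  simp only [layerF, aeval_toT] at this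
  exact this

end GapCalculus

end Summit.KontsevichZagierPeriods.RootDecompZetaThreeFrontier.WordLayer

/-! # §38  THE ENGINE STEPS IN GAP COORDINATES (decomp-kz lens-1 gen 11): gap-world remainder operators `gR2Q/gRc2Q/gR1Q/gR1'Q` (+ duals via `gdual`)
with `toT (gR…Q H Qg …) = lowR…Q (toT H) (toT Qg) …`, and the eight Q-generic steps restated for gap-world numerators `toT H`.  After this a rule of the
decision list (NODE.md ADDENDUM 9) is applied by: choosing `Qg`, expanding `gR…Q (monomial κ q) Qg` into gap monomials (pure `ℚ[g]` algebra:
`pderiv_monomial`, products with the linear forms below), and checking the five inequalities per monomial. -/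

namespace Summit.KontsevichZagierPeriods.RootDecompZetaThreeFrontier.WordLayer

open Set MeasureTheory Literature.NumberTheory.Transcendental MvPolynomial

section GapSteps

/-- the den factors `t₀, t₁, 1-t₁, 1-t₂, t₀-t₂` as gap-linear forms -/
noncomputable def fB0 : MvPolynomial (Fin 4) ℚ := X 1 + X 2 + X 3
/-- Auxiliary step `fB1`. [bookkeeping] -/
noncomputable def fB1 : MvPolynomial (Fin 4) ℚ := X 2 + X 3
/-- Auxiliary step `fC1`. [bookkeeping] -/
noncomputable def fC1 : MvPolynomial (Fin 4) ℚ := X 0 + X 1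
/-- Auxiliary step `fC2`. [bookkeeping] -/
noncomputable def fC2 : MvPolynomial (Fin 4) ℚ := X 0 + X 1 + X 2
/-- Auxiliary step `fAl`. [bookkeeping] -/
noncomputable def fAl : MvPolynomial (Fin 4) ℚ := X 1 + X 2

/-- Auxiliary step `toT_fB0'`. [bookkeeping] -/
@[simp] theorem toT_fB0' : toT fB0 = X 0 := toT_fB0
/-- Auxiliary step `toT_fB1'`. [bookkeeping] -/
@[simp] theorem toT_fB1' : toT fB1 = X 1 := toT_fB1
/-- Auxiliary step `toT_fC1'`. [bookkeeping] -/
@[simp] theorem toT_fC1' : toT fC1 = C 1 - X 1 := toT_fC1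
/-- Auxiliary step `toT_fC2'`. [bookkeeping] -/
@[simp] theorem toT_fC2' : toT fC2 = C 1 - X 2 := toT_fC2
/-- Auxiliary step `toT_fAl'`. [bookkeeping] -/
@[simp] theorem toT_fAl' : toT fAl = X 0 - X 2 := toT_fAl

/-- gap-world `lowR2Q`:  `-(1/a)(∂₂H·(1-t₂) + g H) - corr2` -/
noncomputable def gR2Q (H Qg : MvPolynomial (Fin 4) ℚ) (g a : ℕ) : MvPolynomial (Fin 4) ℚ :=
  -(C (1 / (a : ℚ)) * (gD 2 H * fC2 + C (g : ℚ) * H)) - (gD 2 (fAl * Qg) * fC2 + Qg * (C (g : ℚ) * fAl + C (a : ℚ) * fC2))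
/-- gap-world `lowRc2Q`: `-(1/g)(∂₂H·(t₀-t₂) + a H) - corrC2` -/
noncomputable def gRc2Q (H Qg : MvPolynomial (Fin 4) ℚ) (g a : ℕ) : MvPolynomial (Fin 4) ℚ :=
  -(C (1 / (g : ℚ)) * (gD 2 H * fAl + C (a : ℚ) * H)) - (gD 2 (fC2 * Qg) * fAl + Qg * (C (g : ℚ) * fAl + C (a : ℚ) * fC2))
/-- gap-world `lowR1Q`:  `(1/b)(∂₁H·(1-t₁) + c H) - corr1` -/
noncomputable def gR1Q (H Qg : MvPolynomial (Fin 4) ℚ) (b c : ℕ) : MvPolynomial (Fin 4) ℚ :=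
  C (1 / (b : ℚ)) * (gD 1 H * fC1 + C (c : ℚ) * H) - (gD 1 (fB1 * Qg) * fC1 + Qg * (C (c : ℚ) * fB1 - C (b : ℚ) * fC1))
/-- gap-world `lowR1'Q`: `(1/b)(∂₁H·(1-t₁) + (b+c) H) - corr1` -/
noncomputable def gR1'Q (H Qg : MvPolynomial (Fin 4) ℚ) (b c : ℕ) : MvPolynomial (Fin 4) ℚ :=
  C (1 / (b : ℚ)) * (gD 1 H * fC1 + C ((b + c : ℕ) : ℚ) * H) - (gD 1 (fB1 * Qg) * fC1 + Qg * (C (c : ℚ) * fB1 - C (b : ℚ) * fC1))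
/-- σ₃-duals -/
noncomputable def gR0Q (H Qg : MvPolynomial (Fin 4) ℚ) (g a : ℕ) : MvPolynomial (Fin 4) ℚ := gdual (gR2Q (gdual H) (gdual Qg) g a)
/-- Auxiliary step `gRb0Q`. [bookkeeping] -/
noncomputable def gRb0Q (H Qg : MvPolynomial (Fin 4) ℚ) (g a : ℕ) : MvPolynomial (Fin 4) ℚ := gdual (gRc2Q (gdual H) (gdual Qg) g a)
/-- Auxiliary step `gR1dQ`. [bookkeeping] -/
noncomputable def gR1dQ (H Qg : MvPolynomial (Fin 4) ℚ) (b c : ℕ) : MvPolynomial (Fin 4) ℚ := gdual (gR1Q (gdual H) (gdual Qg) b c)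
/-- Auxiliary step `gR1d'Q`. [bookkeeping] -/
noncomputable def gR1d'Q (H Qg : MvPolynomial (Fin 4) ℚ) (b c : ℕ) : MvPolynomial (Fin 4) ℚ := gdual (gR1'Q (gdual H) (gdual Qg) b c)

/-- Auxiliary step `toT_gR2Q`. [bookkeeping] -/
theorem toT_gR2Q (H Qg : MvPolynomial (Fin 4) ℚ) (g a : ℕ) : toT (gR2Q H Qg g a) = lowR2Q (toT H) (toT Qg) g a := by
  simp only [gR2Q, lowR2Q, lowR2, corr2, map_sub, map_neg, map_mul, map_add, toT_C, ← pderiv_toT, toT_fC2', toT_fAl']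
/-- Auxiliary step `toT_gRc2Q`. [bookkeeping] -/
theorem toT_gRc2Q (H Qg : MvPolynomial (Fin 4) ℚ) (g a : ℕ) : toT (gRc2Q H Qg g a) = lowRc2Q (toT H) (toT Qg) g a := by
  simp only [gRc2Q, lowRc2Q, lowRc2, corrC2, map_sub, map_neg, map_mul, map_add, toT_C, ← pderiv_toT, toT_fC2', toT_fAl']
/-- Auxiliary step `toT_gR1Q`. [bookkeeping] -/
theorem toT_gR1Q (H Qg : MvPolynomial (Fin 4) ℚ) (b c : ℕ) : toT (gR1Q H Qg b c) = lowR1Q (toT H) (toT Qg) b c := by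
  simp only [gR1Q, lowR1Q, lowR1, corr1, map_sub, map_mul, map_add, toT_C, ← pderiv_toT, toT_fC1', toT_fB1']
/-- Auxiliary step `toT_gR1'Q`. [bookkeeping] -/
theorem toT_gR1'Q (H Qg : MvPolynomial (Fin 4) ℚ) (b c : ℕ) : toT (gR1'Q H Qg b c) = lowR1'Q (toT H) (toT Qg) b c := by
  simp only [gR1'Q, lowR1'Q, lowR1', corr1, map_sub, map_mul, map_add, toT_C, ← pderiv_toT, toT_fC1', toT_fB1']

/-- Auxiliary step `gdual_gdual`. [bookkeeping] -/
theorem gdual_gdual (H : MvPolynomial (Fin 4) ℚ) : gdual (gdual H) = H := by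
  induction H using MvPolynomial.induction_on with
  | C a => simp [gdual]
  | add p q hp hq => rw [map_add, map_add, hp, hq]
  | mul_X p i hp =>
    rw [map_mul, map_mul, hp]
    congr 1
    fin_cases i <;> simp [gdual]

/-- Auxiliary step `toT_gdual`. [bookkeeping] -/
theorem toT_gdual (H : MvPolynomial (Fin 4) ℚ) : toT (gdual H) = duP3 (toT H) := (duP3_toT H).symm

/-- Auxiliary step `toT_gR0Q`. [bookkeeping] -/
theorem toT_gR0Q (H Qg : MvPolynomial (Fin 4) ℚ) (g a : ℕ) : toT (gR0Q H Qg g a) = lowR0Q (toT H) (toT Qg) g a := by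
  rw [gR0Q, toT_gdual, toT_gR2Q, toT_gdual, toT_gdual, lowR0Q]
/-- Auxiliary step `toT_gRb0Q`. [bookkeeping] -/
theorem toT_gRb0Q (H Qg : MvPolynomial (Fin 4) ℚ) (g a : ℕ) : toT (gRb0Q H Qg g a) = lowRb0Q (toT H) (toT Qg) g a := by
  rw [gRb0Q, toT_gdual, toT_gRc2Q, toT_gdual, toT_gdual, lowRb0Q]
/-- Auxiliary step `toT_gR1dQ`. [bookkeeping] -/
theorem toT_gR1dQ (H Qg : MvPolynomial (Fin 4) ℚ) (b c : ℕ) : toT (gR1dQ H Qg b c) = lowR1dQ (toT H) (toT Qg) b c := by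
  rw [gR1dQ, toT_gdual, toT_gR1Q, toT_gdual, toT_gdual, lowR1dQ]
/-- Auxiliary step `toT_gR1d'Q`. [bookkeeping] -/
theorem toT_gR1d'Q (H Qg : MvPolynomial (Fin 4) ℚ) (b c : ℕ) : toT (gR1d'Q H Qg b c) = lowR1d'Q (toT H) (toT Qg) b c := by
  rw [gR1d'Q, toT_gdual, toT_gR1'Q, toT_gdual, toT_gdual, lowR1d'Q]

end GapSteps

end Summit.KontsevichZagierPeriods.RootDecompZetaThreeFrontier.WordLayer

namespace Summit.KontsevichZagierPeriods.KontsevichZagierPeriods.Cruxes.GZNormalFormWThree.GZLadder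

open Set MeasureTheory Literature.NumberTheory.Transcendental
open Summit.KontsevichZagierPeriods.RootDecompZetaThreeFrontier

/-- **D6 step in gap coordinates** (`α ↓`, `γ₂ ↑`): numerator `toT H`, remainder `toT (gR2Q H Qg g a)`. -/
theorem lowerT2G (H Qg : MvPolynomial (Fin 4) ℚ) (β₀ β₁ γ₁ g a : ℕ) (ha : 1 ≤ a)
    (hRint : IntegrableOn (WordLayer.layerF (WordLayer.toT (WordLayer.gR2Q H Qg g a)) β₀ β₁ γ₁ (g + 1) a) (KZ.openOrderedSimplex 3))
    (hR : ∀ s : KZ.IntegralRep 3, s.domain = simplex 3 →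
      EqOn s.integrand (WordLayer.layerF (WordLayer.toT (WordLayer.gR2Q H Qg g a)) β₀ β₁ γ₁ (g + 1) a) s.domain → CongInto (layerThree ∪ gzLETwo) (KZ.of s))
    (r : KZ.IntegralRep 3) (hd : r.domain = simplex 3) (hi : EqOn r.integrand (WordLayer.layerF (WordLayer.toT H) β₀ β₁ γ₁ g (a + 1)) r.domain) :
    CongInto (layerThree ∪ gzLETwo) (KZ.of r) := by
  rw [WordLayer.toT_gR2Q] at hRint hR
  exact lowerT2Q _ _ β₀ β₁ γ₁ g a ha hRint hR r hd hi

/-- **D5 step in gap coordinates** (`γ₂ ↓`, `α ↑`). -/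
theorem lowerC2G (H Qg : MvPolynomial (Fin 4) ℚ) (β₀ β₁ γ₁ g a : ℕ) (hg : 1 ≤ g)
    (hRint : IntegrableOn (WordLayer.layerF (WordLayer.toT (WordLayer.gRc2Q H Qg g a)) β₀ β₁ γ₁ g (a + 1)) (KZ.openOrderedSimplex 3))
    (hR : ∀ s : KZ.IntegralRep 3, s.domain = simplex 3 →
      EqOn s.integrand (WordLayer.layerF (WordLayer.toT (WordLayer.gRc2Q H Qg g a)) β₀ β₁ γ₁ g (a + 1)) s.domain → CongInto (layerThree ∪ gzLETwo) (KZ.of s))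
    (r : KZ.IntegralRep 3) (hd : r.domain = simplex 3) (hi : EqOn r.integrand (WordLayer.layerF (WordLayer.toT H) β₀ β₁ γ₁ (g + 1) a) r.domain) :
    CongInto (layerThree ∪ gzLETwo) (KZ.of r) := by
  rw [WordLayer.toT_gRc2Q] at hRint hR
  exact lowerC2Q _ _ β₀ β₁ γ₁ g a hg hRint hR r hd hi

/-- **D3 step in gap coordinates** (`β₁ ↓`, `γ₁ ↑`). -/
theorem lowerT1G (H Qg : MvPolynomial (Fin 4) ℚ) (β₀ b c γ₂ α : ℕ) (hb : 1 ≤ b)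
    (hRint : IntegrableOn (WordLayer.layerF (WordLayer.toT (WordLayer.gR1Q H Qg b c)) β₀ b (c + 1) γ₂ α) (KZ.openOrderedSimplex 3))
    (hR : ∀ s : KZ.IntegralRep 3, s.domain = simplex 3 →
      EqOn s.integrand (WordLayer.layerF (WordLayer.toT (WordLayer.gR1Q H Qg b c)) β₀ b (c + 1) γ₂ α) s.domain → CongInto (layerThree ∪ gzLETwo) (KZ.of s))
    (r : KZ.IntegralRep 3) (hd : r.domain = simplex 3) (hi : EqOn r.integrand (WordLayer.layerF (WordLayer.toT H) β₀ (b + 1) c γ₂ α) r.domain) :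
    CongInto (layerThree ∪ gzLETwo) (KZ.of r) := by
  rw [WordLayer.toT_gR1Q] at hRint hR
  exact lowerT1Q _ _ β₀ b c γ₂ α hb hRint hR r hd hi

/-- γ₁-preserving t₁-step in gap coordinates. -/
theorem lowerT1'G (H Qg : MvPolynomial (Fin 4) ℚ) (β₀ b c γ₂ α : ℕ) (hb : 1 ≤ b)
    (hRint : IntegrableOn (WordLayer.layerF (WordLayer.toT (WordLayer.gR1'Q H Qg b c)) β₀ b (c + 1) γ₂ α) (KZ.openOrderedSimplex 3))
    (hR : ∀ s : KZ.IntegralRep 3, s.domain = simplex 3 →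
      EqOn s.integrand (WordLayer.layerF (WordLayer.toT (WordLayer.gR1'Q H Qg b c)) β₀ b (c + 1) γ₂ α) s.domain → CongInto (layerThree ∪ gzLETwo) (KZ.of s))
    (r : KZ.IntegralRep 3) (hd : r.domain = simplex 3) (hi : EqOn r.integrand (WordLayer.layerF (WordLayer.toT H) β₀ (b + 1) (c + 1) γ₂ α) r.domain) :
    CongInto (layerThree ∪ gzLETwo) (KZ.of r) := by
  rw [WordLayer.toT_gR1'Q] at hRint hR
  exact lowerT1'Q _ _ β₀ b c γ₂ α hb hRint hR r hd hi

end Summit.KontsevichZagierPeriods.KontsevichZagierPeriods.Cruxes.GZNormalFormWThree.GZLadder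
end
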